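import Summits.KontsevichZagierPeriods.Zeta5Search.TwoTaleLineBoundRC
import Summits.KontsevichZagierPeriods.Zeta5Search.TwoTaleLineBoundScaling
import Summits.KontsevichZagierPeriods.Zeta5Search.TwoTaleLineBoundLipschitz
import Summits.KontsevichZagierPeriods.Zeta5Search.TwoTaleLineBoundStirling
import Summits.KontsevichZagierPeriods.Zeta5Search.Denom.TwoTaleR3Forms

/-!
# Rung A: the scaled line bound `log ‖R_n‖ ≤ n·rateGA(η) + O(log n + log(121+η²))` on `x = ⌊23n/10⌋ + ½`

HONEST FRAMING: systematic search; no irrationality claim unless certified.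

Cell pub-zeta5, T3 service (P1 g9).  Rung A = Zudilin's Remark-3 point `a = (6n+1, 5n+1, 4n+1, 7n+1)`,
`b = (1, n+1, 2n+1, 12n+2)` (fam-denom's `aRungA/bRungA`; `InclusionA`, `WhippleA`, `CoeffRateA` are tree theorems, so
`DecayA` is the ONLY remaining input of `zetaTwo_exponent_le_A : … → ExponentLE (zetaValue 2) 5.2053`).  This file is
the rung-A twin of `TwoTaleP15LineBoundRate` (brick E5-2): on the vertical line `Re t = xₙ + ½`, `xₙ = ⌊23n/10⌋`
(design abscissa `ξ = 23/10`, vertline `ξ* = 2.3019`, `η* = 0.926`, `min–max = −13.22912875` = fam-denom's `DecayA` model),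
`u = xₙ + ½ − (5n+1)`, `y = nη`, `η ≠ 0`, `n ≥ 3`:

* general endpoint lemmas `prim_endpoint_gen`, `halfLog_endpoint_gen` (any `m ≤ |V*| − 3/(2n)`, `|V*| + 3/2 ≤ M`);
* `rateGA η := Σ± prim η Vᵢ* + 7 + (5 log 5 − 6 log 6 − 4 log 4 − 2 log 2)`,
  `V* = (33/10, −27/10 | 23/10, −17/10 | 13/10, −7/10 ‖ 93/10, 43/10)`;
* **`log_norm_RC_rungA_line_le`**: `log ‖RC (aRungA n) (bRungA n) (uₙ + i·nη)‖ ≤ n·rateGA η + 2 log n + 9 log(121+η²) + K_A`,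
  `K_A = 12|log(1/5)| + 3(1+log 2) + 1`.
What remains for `DecayA` (fam-denom): the rung-A line representation + strip shift (clones of `Denom/TwoTaleP15Decay`,
`…StripShift`, `…LineRep` with `Zudilin2014.RC (aRungA n) (bRungA n)`), the certificate `max_η (rateGA η − 2π|η|) ≤ −c₀`
(numerically `−13.2291` at `η ≈ 0.926`), and the `dy`-assembly (clone of `TwoTaleP15LineBoundDecaySharp`).
-/

noncomputable section

open Real Complex
open Literature.NumberTheory.Irrationality.Zudilin2014

namespace Summit.KontsevichZagierPeriods.Zeta5Search.TwoTaleLineBound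

open Denom.TwoTaleR3Forms (aRungA bRungA aRungA_zero aRungA_one aRungA_two aRungA_three bRungA_zero bRungA_one
  bRungA_two bRungA_three)

variable {η : ℝ}

/-! ### General endpoint lemmas -/

/-- **Endpoint transfer, general constants**: `|E − nV*| ≤ 3/2`, `m + 3/(2n) ≤ |V*|`, `|V*| + 3/2 ≤ M` (`0 < m`, `1 ≤ M`)
give `|prim (nη) E − (n·prim η V* + E·log n)| ≤ (3/2)(|log m| + ½log(M²+η²))`. -/
theorem prim_endpoint_gen (hη : η ≠ 0) {n : ℕ} (hn : 1 ≤ n) {m M E Vs : ℝ} (hm : 0 < m) (hM : 1 ≤ M)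
    (hE : |E - n * Vs| ≤ 3 / 2) (hlow : m + 3 / (2 * n) ≤ |Vs|) (hup : |Vs| + 3 / 2 ≤ M) :
    |prim (n * η) E - (n * prim η Vs + E * Real.log n)| ≤ 3 / 2 * (|Real.log m| + Real.log (M ^ 2 + η ^ 2) / 2) := by
  have hn0 : (0 : ℝ) < n := by exact_mod_cast hn
  have hn1 : (1 : ℝ) ≤ n := by exact_mod_cast hn
  obtain ⟨V, hV⟩ : ∃ V : ℝ, V = E / n := ⟨_, rfl⟩
  have hEV : E = n * V := by rw [hV]; field_simp
  rw [hEV, prim_scale hn0 hη V, show (n : ℝ) * prim η V + n * V * Real.log n - (n * prim η Vs + n * V * Real.log n) =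
    n * (prim η V - prim η Vs) by ring, abs_mul, abs_of_pos hn0]
  have hdist : (n : ℝ) * |V - Vs| ≤ 3 / 2 := by
    have : |E - n * Vs| = n * |V - Vs| := by rw [hEV, ← mul_sub, abs_mul, abs_of_pos hn0]
    rw [← this]; exact hE
  have hdn : |V - Vs| ≤ 3 / (2 * n) := by
    rw [le_div_iff₀ (by positivity)]; nlinarith [abs_nonneg (V - Vs)]
  have hdist' : |V - Vs| ≤ 3 / 2 := by nlinarith [abs_nonneg (V - Vs)]
  have hseg : ∀ W ∈ Set.uIcc Vs V, m ≤ |W| ∧ |W| ≤ M := by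
    intro W hW
    have hWd : |W - Vs| ≤ |V - Vs| := Set.abs_sub_left_of_mem_uIcc hW
    have h1 : |Vs| - |W - Vs| ≤ |W| := by
      have := abs_sub_abs_le_abs_sub Vs W
      rw [abs_sub_comm] at this
      linarith
    have h2 : |W| ≤ |Vs| + |W - Vs| := by
      have := abs_add_le Vs (W - Vs)
      simpa using this
    constructor <;> linarith
  have hL := abs_prim_sub_prim_le hη hm hM hseg
  have hK : 0 ≤ |Real.log m| + Real.log (M ^ 2 + η ^ 2) / 2 := by
    have : 0 ≤ Real.log (M ^ 2 + η ^ 2) := Real.log_nonneg (by nlinarith [sq_nonneg η])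
    positivity
  calc (n : ℝ) * |prim η V - prim η Vs| ≤ n * ((|Real.log m| + Real.log (M ^ 2 + η ^ 2) / 2) * |V - Vs|) :=
        mul_le_mul_of_nonneg_left hL hn0.le
    _ = (|Real.log m| + Real.log (M ^ 2 + η ^ 2) / 2) * (n * |V - Vs|) := by ring
    _ ≤ (|Real.log m| + Real.log (M ^ 2 + η ^ 2) / 2) * (3 / 2) := mul_le_mul_of_nonneg_left hdist hK
    _ = 3 / 2 * (|Real.log m| + Real.log (M ^ 2 + η ^ 2) / 2) := by ring

/-- An endpoint halfLog term, general constant: `|E| ≤ M·n` gives `halfLog (nη) E ≤ log n + ½log(M²+η²)`. -/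
theorem halfLog_endpoint_gen (hη : η ≠ 0) {n : ℕ} (hn : 1 ≤ n) {M E : ℝ} (hM : 0 ≤ M) (hE : |E| ≤ M * n) :
    halfLog (n * η) E ≤ Real.log n + Real.log (M ^ 2 + η ^ 2) / 2 := by
  have hn0 : (0 : ℝ) < n := by exact_mod_cast hn
  obtain ⟨V, hV⟩ : ∃ V : ℝ, V = E / n := ⟨_, rfl⟩
  have hEV : E = n * V := by rw [hV]; field_simp
  rw [hEV, halfLog_scale hn0 hη V]
  have hVb : |V| ≤ M := by
    rw [hV, abs_div, abs_of_pos hn0, div_le_iff₀ hn0]; exact hE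
  have h2 : Real.log (V ^ 2 + η ^ 2) ≤ Real.log (M ^ 2 + η ^ 2) :=
    Real.log_le_log (by positivity) (by nlinarith [abs_nonneg V, sq_abs V, abs_le.1 hVb])
  have h3 : halfLog η V ≤ Real.log (M ^ 2 + η ^ 2) / 2 := by
    unfold halfLog; exact div_le_div_of_nonneg_right h2 (by norm_num)
  exact add_le_add_right h3 (Real.log n)

/-! ### Rung A data -/

/-- The abscissa `xₙ = ⌊23n/10⌋` (design `ξ = 23/10`). -/
def xLineA (n : ℕ) : ℕ := 23 * n / 10

/-- `u = xₙ + ½ − (5n+1)` (`a₂* = 5n+1` at rung A). -/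
def uLineA (n : ℕ) : ℝ := (xLineA n : ℝ) + 1 / 2 - (5 * n + 1)

/-- The entropy row of `Π = (5n)!/((6n)!(4n)!(2n)!)`. -/
def kappaA : ℝ := 5 * Real.log 5 - 6 * Real.log 6 - 4 * Real.log 4 - 2 * Real.log 2

/-- **The rung-A rate function** `Σ± prim η Vᵢ* + 7 + κ_A`. -/
def rateGA (η : ℝ) : ℝ :=
  (prim η (33 / 10) - prim η (-27 / 10)) + (prim η (23 / 10) - prim η (-17 / 10)) + (prim η (13 / 10) - prim η (-7 / 10))
    - (prim η (93 / 10) - prim η (43 / 10)) + 7 + kappaA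

/-- Floor bookkeeping: `−3/2 ≤ uₙ + 27n/10 ≤ −1/2`. -/
theorem uLineA_bounds (n : ℕ) : -3 / 2 ≤ uLineA n + 27 * n / 10 ∧ uLineA n + 27 * n / 10 ≤ -1 / 2 := by
  unfold uLineA xLineA
  have h1 : 10 * (23 * n / 10) ≤ 23 * n := Nat.mul_div_le _ _
  have h2 : 23 * n < 10 * (23 * n / 10) + 10 := by omega
  have h1' : (10 : ℝ) * ((23 * n / 10 : ℕ) : ℝ) ≤ 23 * n := by exact_mod_cast h1
  have h2' : (23 : ℝ) * n < 10 * ((23 * n / 10 : ℕ) : ℝ) + 10 := by exact_mod_cast h2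
  constructor <;> linarith

/-- `Π` at rung A: `(5n)!/((6n)!(4n)!(2n)!)`. -/
theorem Pi_rungA (n : ℕ) :
    Pi (aRungA n) (bRungA n) = (Nat.factorial (5 * n) : ℚ) /
      ((Nat.factorial (6 * n) : ℚ) * Nat.factorial (4 * n) * Nat.factorial (2 * n)) := by
  unfold Pi numFac facZ
  have e3 : (bRungA n 3 - aRungA n 3 - 1).toNat = 5 * n := by simp; omega
  have e0 : (aRungA n 0 - bRungA n 0).toNat = 6 * n := by simp; omega
  have e1 : (aRungA n 1 - bRungA n 1).toNat = 4 * n := by simp; omega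
  have e2 : (aRungA n 2 - bRungA n 2).toNat = 2 * n := by simp; omega
  rw [e3, e0, e1, e2]

set_option maxHeartbeats 400000 in
/-- **The scaled line bound at rung A** (`n ≥ 3`, `η ≠ 0`):
`log ‖RC a b (uₙ + i·nη)‖ ≤ n·rateGA η + 2 log n + 9 log(121 + η²) + (12|log(1/5)| + 3(1 + log 2) + 1)`. -/
theorem log_norm_RC_rungA_line_le (hη : η ≠ 0) {n : ℕ} (hn : 3 ≤ n) :
    Real.log ‖RC (aRungA n) (bRungA n) ((uLineA n : ℂ) + (((n : ℝ) * η : ℝ) : ℂ) * I)‖ ≤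
      n * rateGA η + 2 * Real.log n + 9 * Real.log (11 ^ 2 + η ^ 2)
        + (12 * |Real.log (1 / 5)| + 3 * (1 + Real.log 2) + 1) := by
  have hn1 : 1 ≤ n := by omega
  have hn0 : (0 : ℝ) < n := by exact_mod_cast hn1
  have hnr1 : (1 : ℝ) ≤ n := by exact_mod_cast hn1
  have hn3 : (3 : ℝ) ≤ n := by exact_mod_cast hn
  have hy : (n : ℝ) * η ≠ 0 := mul_ne_zero hn0.ne' hη
  obtain ⟨hu1, hu2⟩ := uLineA_bounds n
  set u : ℝ := uLineA n with hu
  have hB := log_norm_RC_le hy (a := aRungA n) (b := bRungA n)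
    (fun j hj => by fin_cases j <;> simp at hj ⊢ <;> omega) (by simp; omega) (u := u)
    (by simp only [aRungA_three]; push_cast; linarith)
  simp only [aRungA_zero, aRungA_one, aRungA_two, aRungA_three, bRungA_zero, bRungA_one, bRungA_two,
    bRungA_three] at hB
  push_cast at hB
  -- |log Π| = log(5n)! − log(6n)! − log(4n)! − log(2n)!
  have hPi : Real.log |((Pi (aRungA n) (bRungA n) : ℚ) : ℝ)| = Real.log (Nat.factorial (5 * n)) -
      Real.log (Nat.factorial (6 * n)) - Real.log (Nat.factorial (4 * n)) - Real.log (Nat.factorial (2 * n)) := by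
    rw [Pi_rungA]
    have f5 : (0 : ℝ) < Nat.factorial (5 * n) := by exact_mod_cast Nat.factorial_pos _
    have f6 : (0 : ℝ) < Nat.factorial (6 * n) := by exact_mod_cast Nat.factorial_pos _
    have f4 : (0 : ℝ) < Nat.factorial (4 * n) := by exact_mod_cast Nat.factorial_pos _
    have f2 : (0 : ℝ) < Nat.factorial (2 * n) := by exact_mod_cast Nat.factorial_pos _
    push_cast
    rw [abs_of_pos (by positivity), Real.log_div f5.ne' (by positivity), Real.log_mul (by positivity) f2.ne',
      Real.log_mul f6.ne' f4.ne']
    ring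
  rw [hPi] at hB
  -- the 3/(2n) ≤ |V*| − 1/5 conditions use n ≥ 3
  have hlow : (1:ℝ) / 5 + 3 / (2 * n) ≤ 7 / 10 := by
    have : 3 / (2 * (n : ℝ)) ≤ 1 / 2 := by rw [div_le_iff₀ (by positivity)]; linarith
    linarith
  -- the eight endpoints (m = 1/5, M = 11)
  have a1 : |(33:ℝ) / 10| = 33 / 10 := abs_of_pos (by norm_num)
  have a2 : |(-27:ℝ) / 10| = 27 / 10 := by rw [abs_of_neg (by norm_num)]; norm_num
  have a3 : |(23:ℝ) / 10| = 23 / 10 := abs_of_pos (by norm_num)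
  have a4 : |(-17:ℝ) / 10| = 17 / 10 := by rw [abs_of_neg (by norm_num)]; norm_num
  have a5 : |(13:ℝ) / 10| = 13 / 10 := abs_of_pos (by norm_num)
  have a6 : |(-7:ℝ) / 10| = 7 / 10 := by rw [abs_of_neg (by norm_num)]; norm_num
  have a7 : |(93:ℝ) / 10| = 93 / 10 := abs_of_pos (by norm_num)
  have a8 : |(43:ℝ) / 10| = 43 / 10 := abs_of_pos (by norm_num)
  have hm : (0:ℝ) < 1 / 5 := by norm_num
  have hM : (1:ℝ) ≤ 11 := by norm_num
  obtain ⟨e1a, e1b⟩ := abs_le.1 (prim_endpoint_gen hη hn1 (E := u + 6 * n) (Vs := 33 / 10) hm hM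
    (by rw [abs_le]; constructor <;> linarith) (by rw [a1]; linarith) (by rw [a1]; norm_num))
  obtain ⟨e2a, e2b⟩ := abs_le.1 (prim_endpoint_gen hη hn1 (E := u + 1) (Vs := -27 / 10) hm hM
    (by rw [abs_le]; constructor <;> linarith) (by rw [a2]; linarith) (by rw [a2]; norm_num))
  obtain ⟨e3a, e3b⟩ := abs_le.1 (prim_endpoint_gen hη hn1 (E := u + 5 * n) (Vs := 23 / 10) hm hM
    (by rw [abs_le]; constructor <;> linarith) (by rw [a3]; linarith) (by rw [a3]; norm_num))
  obtain ⟨e4a, e4b⟩ := abs_le.1 (prim_endpoint_gen hη hn1 (E := u + (n + 1)) (Vs := -17 / 10) hm hM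
    (by rw [abs_le]; constructor <;> linarith) (by rw [a4]; linarith) (by rw [a4]; norm_num))
  obtain ⟨e5a, e5b⟩ := abs_le.1 (prim_endpoint_gen hη hn1 (E := u + 4 * n) (Vs := 13 / 10) hm hM
    (by rw [abs_le]; constructor <;> linarith) (by rw [a5]; linarith) (by rw [a5]; norm_num))
  obtain ⟨e6a, e6b⟩ := abs_le.1 (prim_endpoint_gen hη hn1 (E := u + (2 * n + 1)) (Vs := -7 / 10) hm hM
    (by rw [abs_le]; constructor <;> linarith) (by rw [a6]; linarith) (by rw [a6]; norm_num))
  obtain ⟨e7a, e7b⟩ := abs_le.1 (prim_endpoint_gen hη hn1 (E := u + (12 * n + 1)) (Vs := 93 / 10) hm hM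
    (by rw [abs_le]; constructor <;> linarith) (by rw [a7]; linarith) (by rw [a7]; norm_num))
  obtain ⟨e8a, e8b⟩ := abs_le.1 (prim_endpoint_gen hη hn1 (E := u + 7 * n) (Vs := 43 / 10) hm hM
    (by rw [abs_le]; constructor <;> linarith) (by rw [a8]; linarith) (by rw [a8]; norm_num))
  -- the six endpoint halfLog terms (|E| ≤ 11 n)
  have hM0 : (0:ℝ) ≤ 11 := by norm_num
  have l1 := halfLog_endpoint_gen hη hn1 hM0 (E := u + 1) (by rw [abs_le]; constructor <;> linarith)
  have l2 := halfLog_endpoint_gen hη hn1 hM0 (E := u + 6 * n) (by rw [abs_le]; constructor <;> linarith)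
  have l3 := halfLog_endpoint_gen hη hn1 hM0 (E := u + (n + 1)) (by rw [abs_le]; constructor <;> linarith)
  have l4 := halfLog_endpoint_gen hη hn1 hM0 (E := u + 5 * n) (by rw [abs_le]; constructor <;> linarith)
  have l5 := halfLog_endpoint_gen hη hn1 hM0 (E := u + (2 * n + 1)) (by rw [abs_le]; constructor <;> linarith)
  have l6 := halfLog_endpoint_gen hη hn1 hM0 (E := u + 4 * n) (by rw [abs_le]; constructor <;> linarith)
  -- Stirling
  have c5 : Real.log ((5 * n : ℕ) : ℝ) = Real.log 5 + Real.log n := by push_cast; exact Real.log_mul (by norm_num) hn0.ne'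
  have c6 : Real.log ((6 * n : ℕ) : ℝ) = Real.log 6 + Real.log n := by push_cast; exact Real.log_mul (by norm_num) hn0.ne'
  have c4 : Real.log ((4 * n : ℕ) : ℝ) = Real.log 4 + Real.log n := by push_cast; exact Real.log_mul (by norm_num) hn0.ne'
  have c2 : Real.log ((2 * n : ℕ) : ℝ) = Real.log 2 + Real.log n := by push_cast; exact Real.log_mul (by norm_num) hn0.ne'
  have s5 := (log_factorial_two_sided (n := 5 * n) (by omega)).2
  have s6 := (log_factorial_two_sided (n := 6 * n) (by omega)).1
  have s4 := (log_factorial_two_sided (n := 4 * n) (by omega)).1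
  have s2 := (log_factorial_two_sided (n := 2 * n) (by omega)).1
  rw [c5] at s5; rw [c6] at s6; rw [c4] at s4; rw [c2] at s2
  simp only [Nat.cast_mul, Nat.cast_ofNat] at s5 s6 s4 s2
  have hlogn : 0 ≤ Real.log n := Real.log_nonneg hnr1
  have hlog56 : Real.log 5 ≤ Real.log 6 := Real.log_le_log (by norm_num) (by norm_num)
  have hlog4 : 0 ≤ Real.log 4 := Real.log_nonneg (by norm_num)
  have hlog2 : 0 ≤ Real.log 2 := Real.log_nonneg (by norm_num)
  -- linearise the products
  have p1 : (u + 6 * n) * Real.log n = u * Real.log n + 6 * (n * Real.log n) := by ring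
  have p2 : (u + 1) * Real.log n = u * Real.log n + Real.log n := by ring
  have p3 : (u + 5 * n) * Real.log n = u * Real.log n + 5 * (n * Real.log n) := by ring
  have p4 : (u + (n + 1)) * Real.log n = u * Real.log n + (n * Real.log n) + Real.log n := by ring
  have p5 : (u + 4 * n) * Real.log n = u * Real.log n + 4 * (n * Real.log n) := by ring
  have p6 : (u + (2 * n + 1)) * Real.log n = u * Real.log n + 2 * (n * Real.log n) + Real.log n := by ring
  have p7 : (u + (12 * n + 1)) * Real.log n = u * Real.log n + 12 * (n * Real.log n) + Real.log n := by ring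
  have p8 : (u + 7 * n) * Real.log n = u * Real.log n + 7 * (n * Real.log n) := by ring
  have q5 : (5 * (n : ℝ)) * (Real.log 5 + Real.log n) = 5 * (n * Real.log 5) + 5 * (n * Real.log n) := by ring
  have q6 : (6 * (n : ℝ)) * (Real.log 6 + Real.log n) = 6 * (n * Real.log 6) + 6 * (n * Real.log n) := by ring
  have q4 : (4 * (n : ℝ)) * (Real.log 4 + Real.log n) = 4 * (n * Real.log 4) + 4 * (n * Real.log n) := by ring
  have q2 : (2 * (n : ℝ)) * (Real.log 2 + Real.log n) = 2 * (n * Real.log 2) + 2 * (n * Real.log n) := by ring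
  have hG : (n : ℝ) * rateGA η = n * prim η (33 / 10) - n * prim η (-27 / 10) + (n * prim η (23 / 10) - n * prim η (-17 / 10))
      + (n * prim η (13 / 10) - n * prim η (-7 / 10)) - (n * prim η (93 / 10) - n * prim η (43 / 10)) + 7 * n
      + (5 * (n * Real.log 5) - 6 * (n * Real.log 6) - 4 * (n * Real.log 4) - 2 * (n * Real.log 2)) := by
    unfold rateGA kappaA; ring
  -- normalise the endpoint expressions of hB
  have r1 : u + (6 * (n : ℝ) + 1 - 1) = u + 6 * n := by ring
  have r2 : u + (5 * (n : ℝ) + 1 - 1) = u + 5 * n := by ring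
  have r3 : u + (4 * (n : ℝ) + 1 - 1) = u + 4 * n := by ring
  have r4 : u + (12 * (n : ℝ) + 2 - 1) = u + (12 * n + 1) := by ring
  have r5 : u + (7 * (n : ℝ) + 1) - 1 = u + 7 * n := by ring
  rw [r1, r2, r3, r4, r5] at hB
  rw [show (n : ℂ) * (η : ℂ) = (((n : ℝ) * η : ℝ) : ℂ) by push_cast; ring] at hB
  rw [hG]
  linarith [e1a, e1b, e2a, e2b, e3a, e3b, e4a, e4b, e5a, e5b, e6a, e6b, e7a, e7b, e8a, e8b, l1, l2, l3, l4, l5, l6,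
    s5, s6, s4, s2, p1, p2, p3, p4, p5, p6, p7, p8, q5, q6, q4, q2, hB, hlogn, hlog56, hlog4, hlog2]

end Summit.KontsevichZagierPeriods.Zeta5Search.TwoTaleLineBound

end
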